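import Summits.QuantumFields.YangMills.Theses.ContractibleFibre
import Literature.Analysis.OperatorTheory.ConnectedRatioBounds
import Literature.Analysis.OperatorTheory.NonnegativeKernelCovarianceBound
import Literature.Analysis.OperatorTheory.TraceDominationRates
import Literature.Analysis.OperatorTheory.SlabContractionTrivialFibre
import Literature.MeasureTheory.Integral.CountablyGeneratedTrim

/-!
# Stub S2a — trace-formula clustering with an absolute constant

Stub `stub_traceFormulaClustering` of line `trace-vdr` (skeleton `Cruxes/FibreAnchor/Lines/trace_vdr.lean`, lead
reshape r1) for crux `FibreAnchor` (stmt-QuantumFields-16243), route `ContractibleFibre` of `QuantumFields/YangMills`.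
Abstract operator theory: a PSD symmetric bounded non-negative kernel chain with two-sided trace domination (VDR)
`lam^{j+1} ≤ Z_j ≤ lam^{j+1} exp(E e^{−m₀(j+1)})` up to the period `N ≥ (4/m₀) log(2+E) + 4(w+1)` clusters slab
observables at rate `m₀/2` with the ABSOLUTE constant `64·e^{m₀(w+1)}`.

Proof (`core`, countably generated σ-algebra): for `n ≤ 2w+2` the a-priori bound `|cov| ≤ 2` suffices; otherwise
rotate the cycle to `c = 0`, write the slab observables as window functions of `w+2` consecutive sites
(`exists_window_of_local`), contract both windows to bond kernels dominated by the `(w+1)`-step path kernel and pass to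
the heterogeneous cycles on `Fin _` (`cyclic_zero/one/two_noFibre` of `SlabContractionTrivialFibre`), expand in a
countable eigenbasis of the compact self-adjoint PSD transfer operator (`NonnegativeKernelCovarianceBound.kernel_spectral_cov_bound` = trace formulas +
`EigenbasisCovarianceBound.eigenbasis_cov_bound`), and feed the rates extracted from VDR and the threshold
(`TraceDominationRates.vdr_rates`).  The general measurable space is reduced to a countably generated sub-σ-algebra
carrying `K, F₁, F₂` (`core_trim`: `CountablyGeneratedTrim.exists_countablyGenerated_data`, `integral_pi_trim_eq`).
References: Glimm–Jaffe, *Quantum Physics* (1987) §6.1; Osterwalder–Seiler, Ann. Phys. 110 (1978) §2. [folklore]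
-/

set_option autoImplicit false

noncomputable section

namespace Summit.QuantumFields.YangMills.Cruxes.FibreAnchor.TraceVDR

open scoped BigOperators
open MeasureTheory Filter Set Function Literature.Analysis.OperatorTheory Literature.MeasureTheory.Integral
open Summit.QuantumFields.YangMills.Theses.ContractibleFibre

/-- **The core estimate** (countably generated σ-algebra): see the module docstring. [folklore] -/
theorem core {X : Type} [mX : MeasurableSpace X] [hcg : MeasurableSpace.CountablyGenerated X] {μ : Measure X}
    [hμ : IsProbabilityMeasure μ] {K : X → X → ℝ} {B : ℝ} (hKm : Measurable (uncurry K)) (hB : ∀ x y, K x y ≤ B)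
    (hK0 : ∀ x y, 0 ≤ K x y) (hsymm : ∀ x y, K x y = K y x)
    (hpsd : ∀ f : X → ℝ, Measurable f → (∀ x, |f x| ≤ 1) → 0 ≤ ∫ x, (∫ y, f x * K x y * f y ∂μ) ∂μ)
    {m₀ E : ℝ} {w N : ℕ} [NeZero N] (hm₀ : 0 < m₀) (hE : 0 ≤ E)
    (hthr : 4 / m₀ * Real.log (2 + E) + 4 * (w + 1) ≤ (N : ℝ)) {lam₀ : ℝ} (hlam₀ : 0 < lam₀)
    (hlow : ∀ j : ℕ, 1 ≤ j → lam₀ ^ (j + 1) ≤ ∫ V : ZMod (j + 1) → X, ∏ t, K (V t) (V (t + 1)) ∂(Measure.pi fun _ => μ))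
    (hup : ∀ j : ℕ, 1 ≤ j → j + 1 ≤ N → ∫ V : ZMod (j + 1) → X, ∏ t, K (V t) (V (t + 1)) ∂(Measure.pi fun _ => μ) ≤
      lam₀ ^ (j + 1) * Real.exp (E * Real.exp (-(m₀ * (j + 1)))))
    (c : ZMod N) {F₁ F₂ : (ZMod N → X) → ℝ} (hF₁m : Measurable F₁) (hF₁b : ∀ V, |F₁ V| ≤ 1)
    (hF₁l : ∀ V V', (∀ t : ZMod N, (t - c).val ≤ w → V t = V' t) → F₁ V = F₁ V')
    (hF₂m : Measurable F₂) (hF₂b : ∀ V, |F₂ V| ≤ 1)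
    (hF₂l : ∀ V V', (∀ t : ZMod N, (t - c).val ≤ w → V t = V' t) → F₂ V = F₂ V') {n : ℕ} (hn : 2 * n < N) :
    |(∫ V, F₁ V * F₂ (fun t => V (t + n)) * ∏ t, K (V t) (V (t + 1)) ∂(Measure.pi fun _ => μ)) /
        (∫ V : ZMod N → X, ∏ t, K (V t) (V (t + 1)) ∂(Measure.pi fun _ => μ)) -
      (∫ V, F₁ V * ∏ t, K (V t) (V (t + 1)) ∂(Measure.pi fun _ => μ)) /
          (∫ V : ZMod N → X, ∏ t, K (V t) (V (t + 1)) ∂(Measure.pi fun _ => μ)) *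
        ((∫ V, F₂ (fun t => V (t + n)) * ∏ t, K (V t) (V (t + 1)) ∂(Measure.pi fun _ => μ)) /
          (∫ V : ZMod N → X, ∏ t, K (V t) (V (t + 1)) ∂(Measure.pi fun _ => μ)))| ≤
      64 * Real.exp (m₀ * (w + 1)) * Real.exp (-(m₀ / 2 * n)) := by
  /- ### the weight -/
  have hKb' : ∀ x x', 0 ≤ K x x' ∧ K x x' ≤ max B 0 := fun x x' => ⟨hK0 x x', (hB x x').trans (le_max_left _ _)⟩
  have hCc : ∀ x y, ‖K x y‖ ≤ max B 0 := fun x y => by rw [Real.norm_of_nonneg (hK0 x y)]; exact (hKb' x y).2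
  have hPm : Measurable fun V : ZMod N → X => ∏ t, K (V t) (V (t + 1)) :=
    Finset.measurable_prod _ fun t _ => hKm.comp (f := fun V : ZMod N → X => (V t, V (t + 1)))
      ((measurable_pi_apply t).prodMk (measurable_pi_apply (t + 1)))
  have hP0 : ∀ V : ZMod N → X, 0 ≤ ∏ t, K (V t) (V (t + 1)) := fun V => Finset.prod_nonneg fun t _ => hK0 _ _
  have hPb : ∀ V : ZMod N → X, ∏ t, K (V t) (V (t + 1)) ≤ max B 0 ^ N := fun V =>
    calc ∏ t, K (V t) (V (t + 1)) ≤ ∏ _t : ZMod N, max B 0 :=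
          Finset.prod_le_prod (fun t _ => hK0 _ _) fun t _ => (hKb' _ _).2
      _ = max B 0 ^ N := by simp [ZMod.card]
  have hPi : Integrable (fun V : ZMod N → X => ∏ t, K (V t) (V (t + 1))) (Measure.pi fun _ => μ) :=
    Integrable.of_bound hPm.aestronglyMeasurable (max B 0 ^ N)
      (ae_of_all _ fun V => by rw [Real.norm_of_nonneg (hP0 V)]; exact hPb V)
  have hapr : ∀ {G : (ZMod N → X) → ℝ}, (∀ V, |G V| ≤ 1) →
      |∫ V, G V * ∏ t, K (V t) (V (t + 1)) ∂(Measure.pi fun _ => μ)| ≤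
        ∫ V : ZMod N → X, ∏ t, K (V t) (V (t + 1)) ∂(Measure.pi fun _ => μ) := by
    intro G hGb
    rw [← Real.norm_eq_abs]
    refine (norm_integral_le_integral_norm _).trans
      (integral_mono_of_nonneg (ae_of_all _ fun _ => norm_nonneg _) hPi (ae_of_all _ fun V => ?_))
    show ‖G V * ∏ t, K (V t) (V (t + 1))‖ ≤ ∏ t, K (V t) (V (t + 1))
    rw [norm_mul, Real.norm_of_nonneg (hP0 V), Real.norm_eq_abs]
    exact mul_le_of_le_one_left (hP0 V) (hGb V)
  /- ### the degenerate case `Z = 0` and the a-priori bound -/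
  rcases (integral_nonneg (μ := Measure.pi fun _ : ZMod N => μ) (f := fun V : ZMod N → X => ∏ t, K (V t) (V (t + 1)))
    fun V => hP0 V).eq_or_lt with hZ0 | hZpos
  · rw [← hZ0]
    simp only [div_zero, zero_mul, sub_zero, abs_zero]
    positivity
  have h2 : |(∫ V, F₁ V * F₂ (fun t => V (t + n)) * ∏ t, K (V t) (V (t + 1)) ∂(Measure.pi fun _ => μ)) /
        (∫ V : ZMod N → X, ∏ t, K (V t) (V (t + 1)) ∂(Measure.pi fun _ => μ)) -
      (∫ V, F₁ V * ∏ t, K (V t) (V (t + 1)) ∂(Measure.pi fun _ => μ)) /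
          (∫ V : ZMod N → X, ∏ t, K (V t) (V (t + 1)) ∂(Measure.pi fun _ => μ)) *
        ((∫ V, F₂ (fun t => V (t + n)) * ∏ t, K (V t) (V (t + 1)) ∂(Measure.pi fun _ => μ)) /
          (∫ V : ZMod N → X, ∏ t, K (V t) (V (t + 1)) ∂(Measure.pi fun _ => μ)))| ≤ 2 * (1 * 1) := by
    refine abs_div_sub_div_mul_div_le hZpos ?_ ?_ ?_
    · rw [one_mul, one_mul]
      exact hapr fun V => by rw [abs_mul]; exact mul_le_one₀ (hF₁b V) (abs_nonneg _) (hF₂b _)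
    · rw [one_mul]; exact hapr hF₁b
    · rw [one_mul]; exact hapr fun V => hF₂b _
  /- ### short separations: the a-priori bound wins -/
  by_cases hwn : n ≤ 2 * w + 2
  · refine h2.trans ?_
    have h1 : (1 : ℝ) ≤ Real.exp (m₀ * (w + 1)) * Real.exp (-(m₀ / 2 * n)) := by
      rw [← Real.exp_add]
      refine Real.one_le_exp ?_
      have hn' : (n : ℝ) ≤ 2 * w + 2 := by exact_mod_cast hwn
      nlinarith
    nlinarith
  push Not at hwn
  /- ### the layout -/
  obtain ⟨a, ha⟩ : ∃ a, n = w + a + 3 := ⟨n - w - 3, by omega⟩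
  obtain ⟨b', hb'⟩ : ∃ b', N = 2 * w + a + b' + 4 + 2 := ⟨N - n - w - 3, by omega⟩
  /- ### rotation to `c = 0` -/
  obtain ⟨G₁, hG₁⟩ : ∃ G₁ : (ZMod N → X) → ℝ, G₁ = fun V => F₁ (fun t => V (t - c)) := ⟨_, rfl⟩
  obtain ⟨G₂, hG₂⟩ : ∃ G₂ : (ZMod N → X) → ℝ, G₂ = fun V => F₂ (fun t => V (t - c)) := ⟨_, rfl⟩
  have hshift : Measurable fun V : ZMod N → X => fun t => V (t - c) :=
    measurable_pi_lambda _ fun t => measurable_pi_apply _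
  have hG₁m : Measurable G₁ := by rw [hG₁]; exact hF₁m.comp hshift
  have hG₂m : Measurable G₂ := by rw [hG₂]; exact hF₂m.comp hshift
  have hG₁b : ∀ V, |G₁ V| ≤ 1 := fun V => by rw [hG₁]; exact hF₁b _
  have hG₂b : ∀ V, |G₂ V| ≤ 1 := fun V => by rw [hG₂]; exact hF₂b _
  have hG₁l : ∀ V V', (∀ t : ZMod N, t.val ≤ w → V t = V' t) → G₁ V = G₁ V' := fun V V' h => by
    rw [hG₁]; exact hF₁l _ _ fun t ht => h (t - c) ht
  have hG₂l : ∀ V V', (∀ t : ZMod N, t.val ≤ w → V t = V' t) → G₂ V = G₂ V' := fun V V' h => by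
    rw [hG₂]; exact hF₂l _ _ fun t ht => h (t - c) ht
  have hI2 : ∫ V, F₁ V * F₂ (fun t => V (t + n)) * ∏ t, K (V t) (V (t + 1)) ∂(Measure.pi fun _ => μ) =
      ∫ V, G₁ V * G₂ (fun t => V (t + n)) * ∏ t, K (V t) (V (t + 1)) ∂(Measure.pi fun _ => μ) := by
    rw [← integral_pi_zmod_comp_sub (μ := μ) c (fun V => F₁ V * F₂ (fun t => V (t + n)) * ∏ t, K (V t) (V (t + 1)))]
    refine integral_congr_ae (ae_of_all _ fun V => ?_)
    show F₁ (fun t => V (t - c)) * F₂ (fun t => V (t + n - c)) * ∏ t, K (V (t - c)) (V (t + 1 - c)) =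
      G₁ V * G₂ (fun t => V (t + n)) * ∏ t, K (V t) (V (t + 1))
    rw [prod_zmod_comp_sub K V c, hG₁, hG₂]
    dsimp only
    congr 3
    funext t
    rw [add_sub_right_comm]
  have hI1a : ∫ V, F₁ V * ∏ t, K (V t) (V (t + 1)) ∂(Measure.pi fun _ => μ) =
      ∫ V, G₁ V * ∏ t, K (V t) (V (t + 1)) ∂(Measure.pi fun _ => μ) := by
    rw [← integral_pi_zmod_comp_sub (μ := μ) c (fun V => F₁ V * ∏ t, K (V t) (V (t + 1)))]
    refine integral_congr_ae (ae_of_all _ fun V => ?_)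
    show F₁ (fun t => V (t - c)) * ∏ t, K (V (t - c)) (V (t + 1 - c)) = G₁ V * ∏ t, K (V t) (V (t + 1))
    rw [prod_zmod_comp_sub K V c, hG₁]
  have hI1b : ∫ V, F₂ (fun t => V (t + n)) * ∏ t, K (V t) (V (t + 1)) ∂(Measure.pi fun _ => μ) =
      ∫ V, G₂ V * ∏ t, K (V t) (V (t + 1)) ∂(Measure.pi fun _ => μ) := by
    have h1 : ∫ V, F₂ (fun t => V (t + n)) * ∏ t, K (V t) (V (t + 1)) ∂(Measure.pi fun _ => μ) =
        ∫ V, F₂ V * ∏ t, K (V t) (V (t + 1)) ∂(Measure.pi fun _ => μ) := by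
      rw [← integral_pi_zmod_comp_add (μ := μ) (n : ZMod N) (fun V => F₂ V * ∏ t, K (V t) (V (t + 1)))]
      refine integral_congr_ae (ae_of_all _ fun V => ?_)
      show F₂ (fun t => V (t + n)) * ∏ t, K (V t) (V (t + 1)) = F₂ (fun t => V (t + n)) * ∏ t, K (V (t + n)) (V (t + 1 + n))
      rw [prod_zmod_comp_add K V (n : ZMod N)]
    rw [h1, ← integral_pi_zmod_comp_sub (μ := μ) c (fun V => F₂ V * ∏ t, K (V t) (V (t + 1)))]
    refine integral_congr_ae (ae_of_all _ fun V => ?_)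
    show F₂ (fun t => V (t - c)) * ∏ t, K (V (t - c)) (V (t + 1 - c)) = G₂ V * ∏ t, K (V t) (V (t + 1))
    rw [prod_zmod_comp_sub K V c, hG₂]
  /- ### window forms -/
  obtain ⟨x₀⟩ : Nonempty X := nonempty_of_isProbabilityMeasure μ
  obtain ⟨α, hαm, hαb, hαw⟩ := exists_window_of_local x₀ hG₁m hG₁b hG₁l
  obtain ⟨β, hβm, hβb, hβw⟩ := exists_window_of_local x₀ hG₂m hG₂b hG₂l
  have hβn : ∀ V : ZMod N → X, G₂ (fun t => V (t + n)) =
      β (fun i : Fin (w + 2) => V ((w + a + 3 + (i : ℕ) : ℕ) : ZMod N)) := by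
    intro V
    rw [hβw]
    congr 1
    funext i
    congr 1
    rw [ha]
    push_cast
    ring
  have hJ2 : ∫ V, G₁ V * G₂ (fun t => V (t + n)) * ∏ t, K (V t) (V (t + 1)) ∂(Measure.pi fun _ => μ) =
      ∫ V : ZMod N → X, α (fun i : Fin (w + 2) => V ((i : ℕ) : ZMod N)) *
        β (fun i : Fin (w + 2) => V ((w + a + 3 + (i : ℕ) : ℕ) : ZMod N)) * ∏ t, K (V t) (V (t + 1))
        ∂(Measure.pi fun _ => μ) :=
    integral_congr_ae (ae_of_all _ fun V => by
      show G₁ V * G₂ (fun t => V (t + n)) * ∏ t, K (V t) (V (t + 1)) = _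
      rw [hβn V, hαw V])
  have hJ1a : ∫ V, G₁ V * ∏ t, K (V t) (V (t + 1)) ∂(Measure.pi fun _ => μ) =
      ∫ V : ZMod N → X, α (fun i : Fin (w + 2) => V ((i : ℕ) : ZMod N)) * ∏ t, K (V t) (V (t + 1))
        ∂(Measure.pi fun _ => μ) :=
    integral_congr_ae (ae_of_all _ fun V => by
      show G₁ V * ∏ t, K (V t) (V (t + 1)) = _
      rw [hαw V])
  have hJ1b : ∫ V, G₂ V * ∏ t, K (V t) (V (t + 1)) ∂(Measure.pi fun _ => μ) =
      ∫ V : ZMod N → X, β (fun i : Fin (w + 2) => V ((i : ℕ) : ZMod N)) * ∏ t, K (V t) (V (t + 1))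
        ∂(Measure.pi fun _ => μ) :=
    integral_congr_ae (ae_of_all _ fun V => by
      show G₂ V * ∏ t, K (V t) (V (t + 1)) = _
      rw [hβw V])
  /- ### contraction to the `Fin` cycles -/
  have e2 := cyclic_two_noFibre (μ := μ) hKm hKb' hαm hβm hαb hβb (a := a) (b' := b') (N := N) hb'
  have e1a := cyclic_one_noFibre (μ := μ) hKm hKb' hαm hαb (N := N) (M := w + a + b' + 3 + 1) (by omega)
  have e1b := cyclic_one_noFibre (μ := μ) hKm hKb' hβm hβb (N := N) (M := w + a + b' + 3 + 1) (by omega)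
  have e0 := cyclic_zero_noFibre (μ := μ) hKm hKb' (N := N) (k := 2 * w + a + b' + 4) (by omega)
  rw [hI2, hI1a, hI1b, hJ2, hJ1a, hJ1b, e2, e1a, e1b, e0]
  /- ### the spectral bound -/
  obtain ⟨ι, lam, i₀, hlam, hZsum, hcov⟩ := kernel_spectral_cov_bound (μ := μ) hKm.stronglyMeasurable hCc hsymm hpsd w
    (blockKernel_stronglyMeasurable hKm hαm) (blockKernel_stronglyMeasurable hKm hβm)
    (fun u u' => by rw [Real.norm_eq_abs]; exact blockKernel_abs_le' hKm hKb' hαb u u')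
    (fun u u' => by rw [Real.norm_eq_abs]; exact blockKernel_abs_le' hKm hKb' hβb u u')
    (blockKernel_abs_le hKm hKb' hαb) (blockKernel_abs_le hKm hKb' hβb) a b'
  /- ### the rates from VDR -/
  have hZf : ∀ m : ℕ, lam₀ ^ (m + 2) ≤ ∫ V : Fin (m + 2) → X, ∏ t, K (V t) (V (t + 1)) ∂(Measure.pi fun _ => μ) :=
    fun m => hlow (m + 1) (by omega)
  have hZu : ∀ m : ℕ, m + 2 ≤ N → ∫ V : Fin (m + 2) → X, ∏ t, K (V t) (V (t + 1)) ∂(Measure.pi fun _ => μ) ≤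
      lam₀ ^ (m + 2) * Real.exp (E * Real.exp (-(m₀ * ((m : ℝ) + 2)))) := fun m hm => by
    have h := hup (m + 1) (by omega) (by omega)
    have e : ((m + 1 : ℕ) : ℝ) + 1 = (m : ℝ) + 2 := by push_cast; ring
    rw [e] at h
    exact h
  obtain ⟨hL, hθ, hRb, hR0, hR1, hnum⟩ := vdr_rates hlam hZsum hlam₀ hm₀ hE hthr hZf hZu hn hb' ha.symm
  exact (hcov _ _ (Real.exp_pos _).le hR0 hR1 hL hθ hRb).trans hnum

/-- **The core estimate on an arbitrary measurable space**, reduced to `core` on a countably generated sub-σ-algebra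
`mX₀ ≤ mX` carrying `K`, `F₁`, `F₂` (here `mX₀` is the instance found by elaboration and the data on `mX` are spelled
out; all integrals are unchanged under trimming). [folklore] -/
theorem core_trim {X : Type} {mX : MeasurableSpace X} [mX₀ : MeasurableSpace X] [hcg : MeasurableSpace.CountablyGenerated X]
    (hle : mX₀ ≤ mX) (μ : @Measure X mX) [hμ : IsProbabilityMeasure μ] {K : X → X → ℝ} {B : ℝ}
    (hKm : Measurable (uncurry K)) (hB : ∀ x y, K x y ≤ B) (hK0 : ∀ x y, 0 ≤ K x y) (hsymm : ∀ x y, K x y = K y x)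
    (hpsd : ∀ f : X → ℝ, Measurable[mX] f → (∀ x, |f x| ≤ 1) → 0 ≤ ∫ x, (∫ y, f x * K x y * f y ∂μ) ∂μ)
    {m₀ E : ℝ} {w N : ℕ} [NeZero N] (hm₀ : 0 < m₀) (hE : 0 ≤ E)
    (hthr : 4 / m₀ * Real.log (2 + E) + 4 * (w + 1) ≤ (N : ℝ)) {lam₀ : ℝ} (hlam₀ : 0 < lam₀)
    (hlow : ∀ j : ℕ, 1 ≤ j → lam₀ ^ (j + 1) ≤ ∫ V : ZMod (j + 1) → X, ∏ t, K (V t) (V (t + 1))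
      ∂(@Measure.pi (ZMod (j + 1)) (fun _ => X) _ (fun _ => mX) fun _ => μ))
    (hup : ∀ j : ℕ, 1 ≤ j → j + 1 ≤ N → ∫ V : ZMod (j + 1) → X, ∏ t, K (V t) (V (t + 1))
      ∂(@Measure.pi (ZMod (j + 1)) (fun _ => X) _ (fun _ => mX) fun _ => μ) ≤
      lam₀ ^ (j + 1) * Real.exp (E * Real.exp (-(m₀ * (j + 1)))))
    (c : ZMod N) {F₁ F₂ : (ZMod N → X) → ℝ} (hF₁m : Measurable F₁) (hF₁b : ∀ V, |F₁ V| ≤ 1)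
    (hF₁l : ∀ V V', (∀ t : ZMod N, (t - c).val ≤ w → V t = V' t) → F₁ V = F₁ V')
    (hF₂m : Measurable F₂) (hF₂b : ∀ V, |F₂ V| ≤ 1)
    (hF₂l : ∀ V V', (∀ t : ZMod N, (t - c).val ≤ w → V t = V' t) → F₂ V = F₂ V') {n : ℕ} (hn : 2 * n < N) :
    |(∫ V, F₁ V * F₂ (fun t => V (t + n)) * ∏ t, K (V t) (V (t + 1))
          ∂(@Measure.pi (ZMod N) (fun _ => X) _ (fun _ => mX) fun _ => μ)) /
        (∫ V : ZMod N → X, ∏ t, K (V t) (V (t + 1)) ∂(@Measure.pi (ZMod N) (fun _ => X) _ (fun _ => mX) fun _ => μ)) -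
      (∫ V, F₁ V * ∏ t, K (V t) (V (t + 1)) ∂(@Measure.pi (ZMod N) (fun _ => X) _ (fun _ => mX) fun _ => μ)) /
          (∫ V : ZMod N → X, ∏ t, K (V t) (V (t + 1)) ∂(@Measure.pi (ZMod N) (fun _ => X) _ (fun _ => mX) fun _ => μ)) *
        ((∫ V, F₂ (fun t => V (t + n)) * ∏ t, K (V t) (V (t + 1))
            ∂(@Measure.pi (ZMod N) (fun _ => X) _ (fun _ => mX) fun _ => μ)) /
          (∫ V : ZMod N → X, ∏ t, K (V t) (V (t + 1)) ∂(@Measure.pi (ZMod N) (fun _ => X) _ (fun _ => mX) fun _ => μ)))| ≤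
      64 * Real.exp (m₀ * (w + 1)) * Real.exp (-(m₀ / 2 * n)) := by
  haveI : IsProbabilityMeasure (μ.trim hle) := isProbabilityMeasure_trim' hle μ
  -- measurability of the integrands on the small σ-algebra
  have hprod : ∀ (k : ℕ) [NeZero k], Measurable fun V : ZMod k → X => ∏ t, K (V t) (V (t + 1)) := fun k _ =>
    Finset.measurable_prod _ fun t _ => hKm.comp (f := fun V : ZMod k → X => (V t, V (t + 1)))
      ((measurable_pi_apply t).prodMk (measurable_pi_apply (t + 1)))
  have hshiftn : Measurable fun V : ZMod N → X => fun t => V (t + n) :=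
    measurable_pi_lambda _ fun t => measurable_pi_apply _
  have hf₂ : Measurable fun V : ZMod N → X => F₁ V * F₂ (fun t => V (t + n)) * ∏ t, K (V t) (V (t + 1)) :=
    (hF₁m.mul (hF₂m.comp hshiftn)).mul (hprod N)
  have hf₁a : Measurable fun V : ZMod N → X => F₁ V * ∏ t, K (V t) (V (t + 1)) := hF₁m.mul (hprod N)
  have hf₁b : Measurable fun V : ZMod N → X => F₂ (fun t => V (t + n)) * ∏ t, K (V t) (V (t + 1)) :=
    (hF₂m.comp hshiftn).mul (hprod N)
  -- the hypotheses on the small σ-algebra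
  have hpsd' : ∀ f : X → ℝ, Measurable f → (∀ x, |f x| ≤ 1) →
      0 ≤ ∫ x, (∫ y, f x * K x y * f y ∂(μ.trim hle)) ∂(μ.trim hle) := by
    intro f hf hf1
    have hg : Measurable (uncurry fun x y => f x * K x y * f y) := by
      have h : Measurable fun p : X × X => f p.1 * K p.1 p.2 * f p.2 :=
        ((hf.comp measurable_fst).mul hKm).mul (hf.comp measurable_snd)
      exact h
    rw [integral_integral_trim_eq hle μ hg]
    exact hpsd f (hf.mono hle le_rfl) hf1
  have hlow' : ∀ j : ℕ, 1 ≤ j → lam₀ ^ (j + 1) ≤ ∫ V : ZMod (j + 1) → X, ∏ t, K (V t) (V (t + 1))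
      ∂(Measure.pi fun _ => μ.trim hle) := fun j hj => by
    rw [integral_pi_trim_eq hle μ (hprod (j + 1))]; exact hlow j hj
  have hup' : ∀ j : ℕ, 1 ≤ j → j + 1 ≤ N → ∫ V : ZMod (j + 1) → X, ∏ t, K (V t) (V (t + 1))
      ∂(Measure.pi fun _ => μ.trim hle) ≤ lam₀ ^ (j + 1) * Real.exp (E * Real.exp (-(m₀ * (j + 1)))) := fun j hj hjN => by
    rw [integral_pi_trim_eq hle μ (hprod (j + 1))]; exact hup j hj hjN
  have key := core (mX := mX₀) (μ := μ.trim hle) hKm hB hK0 hsymm hpsd' hm₀ hE hthr hlam₀ hlow' hup' c hF₁m hF₁b hF₁l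
    hF₂m hF₂b hF₂l hn
  rw [integral_pi_trim_eq hle μ hf₂, integral_pi_trim_eq hle μ hf₁a, integral_pi_trim_eq hle μ hf₁b,
    integral_pi_trim_eq hle μ (hprod N)] at key
  exact key

/-- **Trace-formula clustering from two-sided trace domination (stub S2a of line `trace-vdr`, crux
`FibreAnchor`).** See the skeleton `Cruxes/FibreAnchor/Lines/trace_vdr.lean` for the informal statement and proof plan,
and the module docstring for the proof.
[cite: GlimmJaffe1987, §6.1 Thm 6.1.3] [cite: OsterwalderSeiler1978, §2] -/
theorem stub_traceFormulaClustering :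
    ∀ (X : Type) [MeasurableSpace X] (μ : MeasureTheory.Measure X) [MeasureTheory.IsProbabilityMeasure μ] (K : X → X → ℝ), Measurable (Function.uncurry K) → (∃ B : ℝ, ∀ x y, K x y ≤ B) → (∀ x y, 0 ≤ K x y) → (∀ x y, K x y = K y x) → (∀ f : X → ℝ, Measurable f → (∀ x, |f x| ≤ 1) → 0 ≤ ∫ x, (∫ y, f x * K x y * f y ∂μ) ∂μ) → ∀ (m₀ E : ℝ) (w N : ℕ) [NeZero N], 0 < m₀ → 0 ≤ E → 4 / m₀ * Real.log (2 + E) + 4 * (w + 1) ≤ (N : ℝ) → let Zc : ℕ → ℝ := fun j => ∫ V : ZMod (j + 1) → X, ∏ t, K (V t) (V (t + 1)) ∂(MeasureTheory.Measure.pi fun _ => μ); (∃ lam : ℝ, 0 < lam ∧ (∀ j : ℕ, 1 ≤ j → lam ^ (j + 1) ≤ Zc j) ∧ ∀ j : ℕ, 1 ≤ j → j + 1 ≤ N → Zc j ≤ lam ^ (j + 1) * Real.exp (E * Real.exp (-(m₀ * (j + 1))))) → let Ex : ((ZMod N → X) → ℝ) → ℝ := fun F => (∫ V, F V * ∏ t,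 K (V t) (V (t + 1)) ∂(MeasureTheory.Measure.pi fun _ => μ)) / (∫ V : ZMod N → X, ∏ t, K (V t) (V (t + 1)) ∂(MeasureTheory.Measure.pi fun _ => μ)); let σ : ℕ → (ZMod N → X) → (ZMod N → X) := fun n V t => V (t + n); ∀ c : ZMod N, let Loc := fun F : (ZMod N → X) → ℝ => Measurable F ∧ (∀ V, |F V| ≤ 1) ∧ ∀ V V', (∀ t : ZMod N, (t - c).val ≤ w → V t = V' t) → F V = F V'; ∀ F₁ F₂ : (ZMod N → X) → ℝ, Loc F₁ → Loc F₂ → ∀ n : ℕ, 2 * n < N → |Ex (fun V => F₁ V * F₂ (σ n V)) - Ex F₁ * Ex (fun V => F₂ (σ n V))| ≤ 64 * Real.exp (m₀ * (w + 1)) * Real.exp (-(m₀ / 2 * n)) := by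
  intro X inst μ hμ K hKm hB hK0 hsymm hpsd m₀ E w N hN hm₀ hE hthr Zc hVDR Ex σ c Loc F₁ F₂ hF₁ hF₂ n hn
  obtain ⟨B, hB⟩ := hB
  obtain ⟨lam₀, hlam₀, hlow, hup⟩ := hVDR
  obtain ⟨hF₁m, hF₁b, hF₁l⟩ := hF₁
  obtain ⟨hF₂m, hF₂b, hF₂l⟩ := hF₂
  obtain ⟨m₁, hle, hcg, hKm₁, hF₁m₁, hF₂m₁⟩ := exists_countablyGenerated_data hKm hF₁m hF₂m
  exact @core_trim X inst m₁ hcg hle μ hμ K B hKm₁ hB hK0 hsymm hpsd m₀ E w N hN hm₀ hE hthr lam₀ hlam₀ hlow hup c F₁ F₂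
    hF₁m₁ hF₁b hF₁l hF₂m₁ hF₂b hF₂l n hn

end Summit.QuantumFields.YangMills.Cruxes.FibreAnchor.TraceVDR

end
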